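import Summits.HodgeConjecture.HodgeConjecture.Theorems.GenericDivisibilityGenericDivisibilityBoundedLevelCleanFunnel
import Summits.HodgeConjecture.HodgeConjecture.Theorems.GenericDivisibilityHodgeClassesGenericallyDivisibleFinite
import Literature.AlgebraicGeometry.Motives.UnramifiedCohomology
import Literature.AlgebraicGeometry.HodgeTheory.ZariskiOpenBettiFinitenessProofs
import HarnessLib

/-!
# Route GenericDivisibility — crux C2 `GenericDivisibilityBounded` (stmt-HodgeConjecture-18467):
# `GT = N¹ ∩ H_ℤ`, and the sector `N¹H^{2p}(X;ℂ) = H^{2p}(X;ℂ)` of the heart and of C2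

Line `finite-level-bootstrap`, lead c4 (cycle 6). Sorry-free, definition-free. `X` is smooth
projective over `ℂ`, `H = H^k(X(ℂ); ℤ)`, `z| = z|_{(X∖Z)(ℂ)}`, and (spelled inline, as in the funnel
file `…LevelCleanFunnel`): "`x` is GENERICALLY TORSION" (`x ∈ GT`) means `∃ Z` closed `≠ univ`,
`∃ N ≥ 1`, `N • x| = 0`.

## Main results

* `genericDivisibilityBounded_exists_nsmul_restrict_eq_zero_of_ringChange_mem_supportedClasses` — the
  CONVERSE bridge `N¹ ∩ H_ℤ ⊆ GT`: an integral class of degree `k ≥ 1` whose complexification has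
  coniveau `≥ 1` is killed by some `N ≥ 1` on the complex points of a non-empty Zariski open
  (directedness of the generating kernels of `N¹` — `Motives.mem_coniveauFiltration_iff_exists` —,
  change of coefficients commutes with restriction, and universal coefficients on `(X∖Z)(ℂ)`, whose
  integral homology is finitely generated by Dimca's finiteness theorem, PROVED in the tree);
  with the landed bridge `GT ⊗ ℂ ⊆ N¹` this is `…_genericallyTorsion_iff_ringChange_mem_supportedClasses`:
  **`GT` is EXACTLY the preimage of `N¹H^k(X(ℂ);ℂ)` in `H^k(X(ℂ);ℤ)`**.
* `genericDivisibilityBounded_levelClean_iff_supportedClasses` — hence the heart of the line at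
  `(ℓ, s, X)` reads: `D'(ℓ^s, z) ⇒ ∃ w, (z - ℓ • w) ⊗ ℂ ∈ N¹` ("the `ℓ`-adic generic divisibility
  defect is absorbed by coniveau one after ONE division by `ℓ`").
* `genericDivisibilityBounded_levelClean_of_supportedClasses_eq_top`,
  `genericDivisibilityBounded_at_of_supportedClasses_eq_top`, registered sub-goal
  `stub_heartOfSupportedTop` — **on every smooth projective `X` with `N¹H^k(X(ℂ);ℂ) = H^k(X(ℂ);ℂ)`
  the heart holds at EVERY prime and EVERY level (`w = 0`) and C2 holds in degree `k`.** By the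
  generalised Hodge conjecture this sector is `{X : h^{k,0}(X) = 0}` for `k = 2p = dim X`; it strictly
  contains the Bloch–Srinivas sector `CH₀ ⊗ ℚ` of rank `≤ 1` of `…SmallChowZero` (p157362), e.g.
  `Enriques × K3`, `S × Y` with `p_g(S) = 0` (Künneth + Lefschetz (1,1) on `S`), where `CH₀` is
  infinite-dimensional (Mumford). So the heart `stub_finiteLevel` and C2 are open exactly on the
  `2p`-folds with `N¹H^{2p} ≠ H^{2p}`, i.e. (GHC) with `H^{2p,0} ≠ 0` — the refuters' arena
  (ATTACK.md, Disproof.lean §1), now delimited in Lean on the nose rather than through `CH₀`.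

References: [ColliotTheleneVoisin2012] Prop. 3.3; [BlochOgus1974ENS] (3.8); [HatcherAT2002] §3.1
Thm. 3.2; [Dimca1992] Ch. 1 Cor. (6.10); [GrothendieckTopology1969] §1.
-/

set_option linter.dupNamespace false

noncomputable section

namespace Summit.HodgeConjecture.HodgeConjecture.Theorems

open CategoryTheory AlgebraicGeometry
open Literature.AlgebraicGeometry.Motives Literature.AlgebraicGeometry.HodgeTheory
  Literature.AlgebraicTopology.SingularHomology
open Summit.HodgeConjecture.HodgeConjecture.Theses.GenericDivisibility

/-- Restriction `H^k(X(ℂ);ℤ) → H^k((X∖Z)(ℂ);ℤ)`, the very term of the route decls (notation only). -/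
local notation3 (prettyPrint := false) "Res[" X ", " Z ", " k "]" =>
  singularCohomology.map ℤ ℤ
    (⟨Subtype.val, continuous_subtype_val⟩ : C(complexPointsCompl X Z, ComplexPoints X)) k

/-! ### The converse bridge `N¹ ∩ H_ℤ ⊆ GT` -/

/-- **`N¹ ∩ H_ℤ ⊆ GT`.** On a smooth projective `X`, an integral class `z ∈ H^k(X(ℂ);ℤ)`, `k ≥ 1`,
whose complexification lies in `N¹H^k(X(ℂ);ℂ) = supportedClasses X k 1` is killed by some `N ≥ 1`
on the complex points of some non-empty Zariski open: `z ⊗ ℂ` dies off ONE closed `Z` of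
codimension `≥ 1` (the generating kernels of `N¹` are directed, Bloch–Ogus (3.8)), `Z ≠ X` (the
generic point has codimension `0`), `(z|) ⊗ ℂ = (z ⊗ ℂ)| = 0`, and an integral class on `(X∖Z)(ℂ)`
with zero complexification is torsion by universal coefficients, `H_{k-1}((X∖Z)(ℂ);ℤ)` being
finitely generated (Dimca 1992, Ch. 1 Cor. (6.10), PROVED in the tree).
[cite: BlochOgus1974ENS, (3.8)] [cite: HatcherAT2002, §3.1 Thm. 3.2] [cite: Dimca1992, Ch. 1 Cor. (6.10)] -/
theorem genericDivisibilityBounded_exists_nsmul_restrict_eq_zero_of_ringChange_mem_supportedClasses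
    {n₀ : ℕ} {X : SchemeOver ℂ} (hX : IsSmoothProjective n₀ X) {k : ℕ} (hk : 1 ≤ k)
    {z : singularCohomology ℤ ℤ (ComplexPoints X) k}
    (hz : singularCohomology.ringChange (Int.castRingHom ℂ) (ComplexPoints X) k z ∈
      supportedClasses X k 1) :
    ∃ Z : Set X.left, IsClosed Z ∧ Z ≠ Set.univ ∧ ∃ N : ℕ, 1 ≤ N ∧ N • Res[X, Z, k] z = 0 := by
  rw [← coniveauFiltration_complex] at hz
  obtain ⟨Z, hZ, hcod, h0⟩ := (mem_coniveauFiltration_iff_exists ℂ k).1 hz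
  haveI : IsIntegral X.left := IsSmoothProjective.isIntegral_holds hX
  refine ⟨Z, hZ, (forall_one_le_coheight_iff_ne_univ hZ).1
    (fun t ht ↦ by exact_mod_cast hcod t ht), ?_⟩
  haveI : Module.Finite ℤ (singularHomology ℤ ℤ (complexPointsCompl X Z) (k - 1)) :=
    Dimca1992_finite_singularHomology_complexPointsCompl_holds hX Z hZ (k - 1)
  refine genericDivisibility_exists_nsmul_eq_zero_of_ringChange_eq_zero (k := k - 1) (by omega) _ ?_
  rw [genericDivisibility_ringChange_map]
  exact h0

/-- **`GT = N¹ ∩ H_ℤ`**: on a smooth projective `X`, in degree `k ≥ 1`, an integral class is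
generically torsion iff its complexification has coniveau `≥ 1` (the two bridges
`genericDivisibilityBounded_ringChange_mem_supportedClasses` and
`…_exists_nsmul_restrict_eq_zero_of_ringChange_mem_supportedClasses`). So the integral lattice
`E = H^k(X(ℂ);ℤ)/GT` of the line is `H^k(X(ℂ);ℤ)/(N¹ ∩ H_ℤ)`, of rank `dim_ℂ H^k(X(ℂ);ℂ)/N¹`.
[cite: BlochOgus1974ENS, (3.8)] [cite: Dimca1992, Ch. 1 Cor. (6.10)] -/
theorem genericDivisibilityBounded_genericallyTorsion_iff_ringChange_mem_supportedClasses
    {n₀ : ℕ} {X : SchemeOver ℂ} (hX : IsSmoothProjective n₀ X) {k : ℕ} (hk : 1 ≤ k)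
    (z : singularCohomology ℤ ℤ (ComplexPoints X) k) :
    (∃ Z : Set X.left, IsClosed Z ∧ Z ≠ Set.univ ∧ ∃ N : ℕ, 1 ≤ N ∧ N • Res[X, Z, k] z = 0) ↔
      singularCohomology.ringChange (Int.castRingHom ℂ) (ComplexPoints X) k z ∈
        supportedClasses X k 1 :=
  ⟨genericDivisibilityBounded_ringChange_mem_supportedClasses hX,
    genericDivisibilityBounded_exists_nsmul_restrict_eq_zero_of_ringChange_mem_supportedClasses hX hk⟩

/-! ### The heart of the line, restated through `N¹` -/

/-- **The heart at `(ℓ, s, X)` through `N¹`.** On a smooth projective `X`, in degree `k ≥ 1`: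
level `ℓ^s` is clean ("`D'(ℓ^s, z) ⇒ ∃ w, z - ℓ • w ∈ GT`", the registered heart `stub_finiteLevel`
at one `X`) iff every `z` with `D'(ℓ^s, z)` has some `w` with `(z - ℓ • w) ⊗ ℂ ∈ N¹H^k(X(ℂ);ℂ)`.
[cite: BlochOgus1974ENS, (3.8)] [cite: Dimca1992, Ch. 1 Cor. (6.10)] -/
theorem genericDivisibilityBounded_levelClean_iff_supportedClasses
    {n₀ : ℕ} {X : SchemeOver ℂ} (hX : IsSmoothProjective n₀ X) {k : ℕ} (hk : 1 ≤ k) (ℓ s : ℕ) :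
    (∀ z : singularCohomology ℤ ℤ (ComplexPoints X) k,
      (∃ Z : Set X.left, IsClosed Z ∧ Z ≠ Set.univ ∧
        ∃ (y : singularCohomology ℤ ℤ (complexPointsCompl X Z) k) (M : ℕ), 1 ≤ M ∧
          M • (Res[X, Z, k] z - ℓ ^ s • y) = 0) →
      ∃ w : singularCohomology ℤ ℤ (ComplexPoints X) k, ∃ Z : Set X.left, IsClosed Z ∧
        Z ≠ Set.univ ∧ ∃ N : ℕ, 1 ≤ N ∧ N • Res[X, Z, k] (z - ℓ • w) = 0) ↔
    (∀ z : singularCohomology ℤ ℤ (ComplexPoints X) k,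
      (∃ Z : Set X.left, IsClosed Z ∧ Z ≠ Set.univ ∧
        ∃ (y : singularCohomology ℤ ℤ (complexPointsCompl X Z) k) (M : ℕ), 1 ≤ M ∧
          M • (Res[X, Z, k] z - ℓ ^ s • y) = 0) →
      ∃ w : singularCohomology ℤ ℤ (ComplexPoints X) k,
        singularCohomology.ringChange (Int.castRingHom ℂ) (ComplexPoints X) k (z - ℓ • w) ∈
          supportedClasses X k 1) := by
  refine forall_congr' fun z ↦ imp_congr_right fun _ ↦ exists_congr fun w ↦ ?_
  exact genericDivisibilityBounded_genericallyTorsion_iff_ringChange_mem_supportedClasses hX hk _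

/-! ### The sector `N¹H^k(X(ℂ);ℂ) = H^k(X(ℂ);ℂ)` -/

/-- **The heart at EVERY prime and EVERY level on the sector `N¹ = ⊤`.** On a smooth projective `X`
with `supportedClasses X k 1 = ⊤` (`k ≥ 1`), every integral class of degree `k` is generically
torsion, so "`D'(ℓ^s, z) ⇒ ∃ w, z - ℓ • w ∈ GT`" holds with `w = 0` for all `ℓ, s` — the
divisibility hypothesis is not used. (GHC-shape of the sector: `h^{k,0}(X) = 0`; it contains the
Bloch–Srinivas sector of `…SmallChowZero` and, e.g., `Enriques × K3`.)
[cite: BlochOgus1974ENS, (3.8)] [cite: Dimca1992, Ch. 1 Cor. (6.10)] -/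
theorem genericDivisibilityBounded_levelClean_of_supportedClasses_eq_top
    {n₀ : ℕ} {X : SchemeOver ℂ} (hX : IsSmoothProjective n₀ X) {k : ℕ} (hk : 1 ≤ k)
    (htop : supportedClasses X k 1 = ⊤) (ℓ s : ℕ) :
    ∀ z : singularCohomology ℤ ℤ (ComplexPoints X) k,
      (∃ Z : Set X.left, IsClosed Z ∧ Z ≠ Set.univ ∧
        ∃ (y : singularCohomology ℤ ℤ (complexPointsCompl X Z) k) (M : ℕ), 1 ≤ M ∧
          M • (Res[X, Z, k] z - ℓ ^ s • y) = 0) →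
      ∃ w : singularCohomology ℤ ℤ (ComplexPoints X) k, ∃ Z : Set X.left, IsClosed Z ∧
        Z ≠ Set.univ ∧ ∃ N : ℕ, 1 ≤ N ∧ N • Res[X, Z, k] (z - ℓ • w) = 0 := by
  intro z _
  refine ⟨0, ?_⟩
  rw [smul_zero, sub_zero]
  exact genericDivisibilityBounded_exists_nsmul_restrict_eq_zero_of_ringChange_mem_supportedClasses
    hX hk (htop ▸ Submodule.mem_top)

/-- **C2 at `X` in degree `k` on the sector `N¹ = ⊤`** (the conclusion of the crux is membership in
`supportedClasses X k 1 = ⊤`; recorded in the crux's shape for the sockets).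
[cite: GrothendieckTopology1969, §1] -/
theorem genericDivisibilityBounded_at_of_supportedClasses_eq_top {X : SchemeOver ℂ} {k : ℕ}
    (htop : supportedClasses X k 1 = ⊤) :
    ∀ z : singularCohomology ℤ ℤ (ComplexPoints X) k,
      (∀ m : ℕ, 1 ≤ m → ∃ Z : Set X.left, IsClosed Z ∧ Z ≠ Set.univ ∧
        ∃ y : singularCohomology ℤ ℤ (complexPointsCompl X Z) k, m • y = Res[X, Z, k] z) →
      singularCohomology.ringChange (Int.castRingHom ℂ) (ComplexPoints X) k z ∈
        supportedClasses X k 1 :=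
  fun _ _ ↦ htop ▸ Submodule.mem_top

/-- **Registered sub-goal `stub_heartOfSupportedTop` of stmt-HodgeConjecture-18467 (lead c4): the
heart of line `finite-level-bootstrap` on the sector `N¹H^{2p}(X(ℂ);ℂ) = H^{2p}(X(ℂ);ℂ)`**, at every
prime `ℓ` and level `s`, spelled inline exactly as in the registered heart `stub_finiteLevel`.
[cite: BlochOgus1974ENS, (3.8)] [cite: Dimca1992, Ch. 1 Cor. (6.10)] -/
theorem stub_heartOfSupportedTop : ∀ ⦃p : ℕ⦄ ⦃X : SchemeOver ℂ⦄, 1 ≤ p → IsSmoothProjective (2 * p) X → supportedClasses X (2 * p) 1 = ⊤ → ∀ ℓ s : ℕ, ∀ z : singularCohomology ℤ ℤ (ComplexPoints X) (2 * p), (∃ Z : Set X.left, IsClosed Z ∧ Z ≠ Set.univ ∧ ∃ (y : singularCohomology ℤ ℤ (complexPointsCompl X Z) (2 * p)) (M : ℕ), 1 ≤ M ∧ M • (singularCohomology.map ℤ ℤ (⟨Subtype.val, continuous_subtype_val⟩ : C(complexPointsCompl X Z, ComplexPoints X)) (2 * p) z - ℓ ^ s • y) = 0) → ∃ w : singularCohomology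 ℤ ℤ (ComplexPoints X) (2 * p), ∃ Z : Set X.left, IsClosed Z ∧ Z ≠ Set.univ ∧ ∃ N : ℕ, 1 ≤ N ∧ N • singularCohomology.map ℤ ℤ (⟨Subtype.val, continuous_subtype_val⟩ : C(complexPointsCompl X Z, ComplexPoints X)) (2 * p) (z - ℓ • w) = 0 :=
  fun _ _ hp hX htop ℓ s ↦
    genericDivisibilityBounded_levelClean_of_supportedClasses_eq_top hX (by omega) htop ℓ s

end Summit.HodgeConjecture.HodgeConjecture.Theorems

end
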